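import Mathlib
import HarnessLib
import Summits.ResolutionOfSingularities.ResolutionOfSingularities.Theorems.WildQuotientsWildQuotientResolutionS1KillExitDefsTame
import Summits.ResolutionOfSingularities.ResolutionOfSingularities.Theorems.WildQuotientsWildQuotientResolutionS1aTameToBR
import Summits.ResolutionOfSingularities.ResolutionOfSingularities.Theorems.WeightedInvariantDatumToEmbeddedQuotientSingularitiesSliceCore

/-!
# W4.5c · S1a, line B — (S2)+(S3): the slice application `InducedTorusStatement → TameBRExitCover`

[OURS · L1 W4.5c · NOT a statement of the manuscript · AI kernel work, weaker than expert review]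

`S1.TameToBR.TameBRExitCover` (tame root charts of a `k`-scheme locally of finite type over a perfect field carry a
Bergh–Rydh exit cover) is reduced to the ring-level induced-torus statement `S1.TameToBR.InducedTorusStatement`
((S1), a separate file) by

* (S3a) transporting the `k`-structure of the affine chart `Γ(Y, U)` through the chart isomorphism
  `Γ(Y, U) ≃+* 𝒜 0` to the graded regular ring `B` (the `AddSubgroup` pieces become `k`-submodules, `GradedRing`
  becomes `GradedAlgebra` on the same carriers; finite type over `k` from (T2));
* (S1) the induced torus: `B₀ = 𝒜 0` is the degree-`0` part of a smooth finite-type `ℤᵐ`-graded `k`-algebra `R`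
  with homogeneous units in all degrees `e • χ`;
* (S2) the tree theorem `DatumToEmbedded.QuotientSingularities.exists_slice` at a maximal ideal `P` of `R` lying
  over a maximal ideal of `R₀` above the point;
* (S3b) chart bookkeeping: the étale `k`-morphism `Spec S₀ → Spec R₀ ≅ Spec Γ(Y, U) = U ⊆ Y`; the given point is
  reached by GOING DOWN along the flat map `R₀ → S₀` (no openness of étale morphisms is used); compatibility
  with the structure morphisms.

Main results: `tameBRExitCover_of_inducedTorus : InducedTorusStatement → TameBRExitCover` and the corollary
`stub_tameToBR_of_inducedTorus : InducedTorusStatement → ∀ p, p.Prime → GlobalKillTame p → GlobalKillBR p`.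

(Author res-L1-w45c-idea-2 g15, `d2t/it/TameBRExitCover.lean` b1450bb99bf46ea3; filed by res-L1-w45c-stub-4 g5 per plan-1
DECONFLICT 2026-08-27T21:08:02Z — verbatim but for four one-line docstrings required by the docstring lint.)
-/

set_option linter.dupNamespace false
set_option linter.unusedSectionVars false

noncomputable section

open CategoryTheory Limits AlgebraicGeometry TopologicalSpace DirectSum

namespace Summit.ResolutionOfSingularities.ResolutionOfSingularities.Theorems.WildQuotientResolution.S1.TameToBR

/-! ## (S3a) Transport of the `k`-structure through a degree-zero chart isomorphism -/

section Transport

variable (k : Type) [Field k] {A : Type} [CommRing A] [Algebra k A] {B : Type} [CommRing B]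
  {ι : Type} [DecidableEq ι] [AddCommMonoid ι] (𝒜 : ι → AddSubgroup B) [GradedRing 𝒜]
  (e₀ : A ≃+* ↥(𝒜 0))

/-- The `k`-algebra structure on `B` obtained from `k → A ≃ 𝒜 0 ⊆ B`. [OURS · L1 W4.5c] -/
@[reducible] def chartAlgebra : Algebra k B :=
  ((algebraMap (↥(𝒜 0)) B).comp (e₀.toRingHom.comp (algebraMap k A))).toAlgebra

/-- The transported structure map, on elements. [OURS · L1 W4.5c] -/
theorem chartAlgebra_algebraMap_apply (c : k) :
    letI := chartAlgebra k 𝒜 e₀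
    algebraMap k B c = (e₀ (algebraMap k A c) : B) := rfl

/-- Scalars land in degree `0`. [OURS · L1 W4.5c] -/
theorem algebraMap_mem_zero (c : k) :
    letI := chartAlgebra k 𝒜 e₀
    algebraMap k B c ∈ 𝒜 0 :=
  (e₀ (algebraMap k A c)).2

/-- The graded pieces as `k`-submodules (same carriers). [OURS · L1 W4.5c] -/
def chartPiece (d : ι) : letI := chartAlgebra k 𝒜 e₀; Submodule k B :=
  letI := chartAlgebra k 𝒜 e₀
  { carrier := 𝒜 d
    add_mem' := fun ha hb => add_mem ha hb
    zero_mem' := zero_mem _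
    smul_mem' := fun c x hx => by
      change c • x ∈ 𝒜 d
      rw [Algebra.smul_def]
      simpa only [zero_add] using SetLike.mul_mem_graded (algebraMap_mem_zero k 𝒜 e₀ c) hx }

/-- Membership in a transported piece. [OURS · L1 W4.5c] -/
@[simp] theorem mem_chartPiece {d : ι} {x : B} :
    letI := chartAlgebra k 𝒜 e₀
    x ∈ chartPiece k 𝒜 e₀ d ↔ x ∈ 𝒜 d := Iff.rfl

/-- The transported pieces form a graded monoid. [OURS · L1 W4.5c] -/
theorem chartPiece_gradedMonoid :
    letI := chartAlgebra k 𝒜 e₀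
    SetLike.GradedMonoid (chartPiece k 𝒜 e₀) :=
  letI := chartAlgebra k 𝒜 e₀
  { one_mem := (SetLike.one_mem_graded 𝒜 : (1 : B) ∈ 𝒜 0)
    mul_mem := fun _ _ _ _ ha hb => SetLike.mul_mem_graded (A := 𝒜) ha hb }

/-- The decomposition, transported verbatim (the underlying subtypes coincide). [OURS · L1 W4.5c] -/
@[reducible] def chartDecomposition :
    letI := chartAlgebra k 𝒜 e₀
    DirectSum.Decomposition (chartPiece k 𝒜 e₀) :=
  letI := chartAlgebra k 𝒜 e₀
  { decompose' := (DirectSum.decompose 𝒜 : B → ⨁ i, ↥(𝒜 i))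
    left_inv := DirectSum.Decomposition.left_inv (ℳ := 𝒜)
    right_inv := DirectSum.Decomposition.right_inv (ℳ := 𝒜) }

/-- `GradedAlgebra` structure on the transported pieces. [OURS · L1 W4.5c] -/
@[reducible] def chartGradedAlgebra :
    letI := chartAlgebra k 𝒜 e₀
    GradedAlgebra (chartPiece k 𝒜 e₀) :=
  letI := chartAlgebra k 𝒜 e₀
  { chartPiece_gradedMonoid k 𝒜 e₀, chartDecomposition k 𝒜 e₀ with }

/-- The identity `𝒜 0 ≃+* chartPiece 0`. [OURS · L1 W4.5c] -/
def zeroIdEquiv :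
    letI := chartAlgebra k 𝒜 e₀
    letI := chartGradedAlgebra k 𝒜 e₀
    ↥(𝒜 0) ≃+* ↥(chartPiece k 𝒜 e₀ 0) :=
  letI := chartAlgebra k 𝒜 e₀
  letI := chartGradedAlgebra k 𝒜 e₀
  { toFun := fun x => ⟨x.1, x.2⟩
    invFun := fun x => ⟨x.1, x.2⟩
    left_inv := fun _ => rfl
    right_inv := fun _ => rfl
    map_mul' := fun _ _ => rfl
    map_add' := fun _ _ => rfl }

/-- `B` is of finite type over `k` as soon as `A` is and (T2) holds. [OURS · L1 W4.5c] -/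
theorem finiteType_chart [Algebra.FiniteType k A] (t : Finset B)
    (ht : Subring.closure (((𝒜 0 : AddSubgroup B) : Set B) ∪ ↑t) = ⊤) :
    letI := chartAlgebra k 𝒜 e₀
    Algebra.FiniteType k B := by
  classical
  letI := chartAlgebra k 𝒜 e₀
  let ψ : A →ₐ[k] B :=
    { (algebraMap (↥(𝒜 0)) B).comp e₀.toRingHom with commutes' := fun _ => rfl }
  obtain ⟨G, hG⟩ := Algebra.FiniteType.out (R := k) (A := A)
  refine ⟨⟨G.image ψ ∪ t, ?_⟩⟩
  rw [eq_top_iff]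
  have hle : Subring.closure (((𝒜 0 : AddSubgroup B) : Set B) ∪ ↑t) ≤
      (Algebra.adjoin k (↑(G.image ψ ∪ t) : Set B)).toSubring := by
    rw [Subring.closure_le]
    rintro x (hx | hx)
    · have hxr : x ∈ (Algebra.adjoin k (G : Set A)).map ψ := by
        rw [hG, Algebra.map_top]
        exact ⟨e₀.symm ⟨x, hx⟩, by simp [ψ]⟩
      rw [AlgHom.map_adjoin] at hxr
      refine Algebra.adjoin_mono ?_ hxr
      intro y hy
      simp only [Finset.coe_union, Finset.coe_image, Set.mem_union]
      exact Or.inl hy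
    · exact Algebra.subset_adjoin (by simp [hx])
  intro b _
  have hb : b ∈ Subring.closure (((𝒜 0 : AddSubgroup B) : Set B) ∪ ↑t) := by rw [ht]; trivial
  exact hle hb

end Transport


/-! ## Maximal ideals of a graded ring over a maximal ideal of its degree-zero part -/

section DegreeZero

variable {k : Type} [Field k] {R : Type} [CommRing R] [Algebra k R] {M : Type} [DecidableEq M]
  [AddCommGroup M] (𝓡 : M → Submodule k R) [GradedAlgebra 𝓡]

/-- The degree-`0` component of an element of the ideal generated by an ideal `𝔪` of `R₀` lies in `𝔪`
(because `R → R₀`, `x ↦ x₀` is `R₀`-linear). [OURS · L1 W4.5c] -/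
theorem decompose_zero_mem_of_mem_map (𝔪 : Ideal ↥(𝓡 0)) {x : R}
    (hx : x ∈ 𝔪.map (algebraMap (↥(𝓡 0)) R)) :
    ∀ a : R, ∃ m ∈ 𝔪, ((decompose 𝓡 (a * x) 0 : ↥(𝓡 0)) : R) = (m : R) := by
  rw [Ideal.map] at hx
  refine Submodule.span_induction ?_ ?_ ?_ ?_ hx
  · rintro y ⟨m₀, hm₀, rfl⟩ a
    refine ⟨decompose 𝓡 a 0 * m₀, 𝔪.mul_mem_left _ hm₀, ?_⟩
    rw [SetLike.GradeZero.algebraMap_apply, coe_decompose_mul_of_right_mem_zero 𝓡 (SetLike.coe_mem m₀)]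
    rfl
  · intro a
    exact ⟨0, 𝔪.zero_mem, by simp⟩
  · intro y z _ _ hy hz a
    obtain ⟨m₁, hm₁, h₁⟩ := hy a
    obtain ⟨m₂, hm₂, h₂⟩ := hz a
    refine ⟨m₁ + m₂, 𝔪.add_mem hm₁ hm₂, ?_⟩
    rw [mul_add, decompose_add, DirectSum.add_apply, Submodule.coe_add, h₁, h₂]
    rfl
  · intro b y _ hy a
    obtain ⟨m₁, hm₁, h₁⟩ := hy (a * b)
    exact ⟨m₁, hm₁, by rw [smul_eq_mul, ← mul_assoc, h₁]⟩

/-- Over every maximal ideal `𝔪` of the degree-`0` part `R₀` of a graded ring `R` there is a maximal ideal `P` of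
`R` with `P ∩ R₀ = 𝔪`. [OURS · L1 W4.5c] -/
theorem exists_isMaximal_over (𝔪 : Ideal ↥(𝓡 0)) [h𝔪 : 𝔪.IsMaximal] :
    ∃ P : Ideal R, P.IsMaximal ∧ ∀ r : ↥(𝓡 0), (r : R) ∈ P ↔ r ∈ 𝔪 := by
  let I : Ideal R := 𝔪.map (algebraMap (↥(𝓡 0)) R)
  have key : ∀ r : ↥(𝓡 0), (r : R) ∈ I → r ∈ 𝔪 := by
    intro r hr
    obtain ⟨m₁, hm₁, h₁⟩ := decompose_zero_mem_of_mem_map 𝓡 𝔪 hr 1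
    rw [one_mul, decompose_of_mem_same 𝓡 r.2] at h₁
    have : r = m₁ := Subtype.ext h₁
    rw [this]; exact hm₁
  have hI : I ≠ ⊤ := by
    intro h
    have h1 : ((1 : ↥(𝓡 0)) : R) ∈ I := by rw [h]; trivial
    exact h𝔪.ne_top (Ideal.eq_top_of_isUnit_mem _ (key 1 h1) isUnit_one)
  obtain ⟨P, hP, hIP⟩ := Ideal.exists_le_maximal I hI
  refine ⟨P, hP, fun r => ⟨fun hr => ?_, fun hr => hIP (Ideal.mem_map_of_mem _ hr)⟩⟩
  have hJ : 𝔪 ≤ P.comap (algebraMap (↥(𝓡 0)) R) := fun m hm => hIP (Ideal.mem_map_of_mem _ hm)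
  have hJ' : P.comap (algebraMap (↥(𝓡 0)) R) ≠ ⊤ := by
    intro h
    have : (1 : ↥(𝓡 0)) ∈ P.comap (algebraMap (↥(𝓡 0)) R) := by rw [h]; trivial
    exact hP.ne_top (Ideal.eq_top_of_isUnit_mem _ (by simpa using this) isUnit_one)
  rw [h𝔪.eq_of_le hJ' hJ]
  exact hr

end DegreeZero


/-! ## (S2)+(S3b) The slice application -/

section Main

/-- **(S2)+(S3)**: the induced-torus statement (S1) implies the Bergh–Rydh exit cover of every `k`-scheme
locally of finite type over a perfect field which is locally tame-root-regular. [OURS · L1 W4.5c] -/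
theorem tameBRExitCover_of_inducedTorus (hIT : InducedTorusStatement) : TameBRExitCover := by
  intro k _ _ Y g hg htame y
  classical
  obtain ⟨U, hyU, hchart⟩ := htame y
  obtain ⟨m, r, B, _, 𝒜, _, hnoeth, hreg, ⟨s, hsu, hsfin⟩, ⟨t, ht⟩, ⟨e₀⟩⟩ := hchart
  have hU : IsAffineOpen (U : Y.Opens) := U.2
  -- (S3a) the `k`-structure of the chart `Γ(Y, U)`, read off `U ⊆ Y → Spec k`
  let φ₀ : CommRingCat.of k ⟶ Γ(Y, (U : Y.Opens)) := Spec.preimage (hU.fromSpec ≫ g)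
  have hφ₀ : Spec.map φ₀ = hU.fromSpec ≫ g := Spec.map_preimage _
  letI algA : Algebra k Γ(Y, (U : Y.Opens)) := φ₀.hom.toAlgebra
  haveI := hg
  haveI : Algebra.FiniteType k Γ(Y, (U : Y.Opens)) := by
    have h1 : LocallyOfFiniteType (Spec.map φ₀) := by
      rw [hφ₀]; exact HasRingHomProperty.comp_of_isOpenImmersion (P := @LocallyOfFiniteType) _ _ hg
    exact (HasRingHomProperty.Spec_iff (P := @LocallyOfFiniteType)).1 h1
  letI := chartAlgebra k 𝒜 e₀
  letI := chartGradedAlgebra k 𝒜 e₀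
  haveI : IsNoetherianRing B := hnoeth
  haveI : Algebra.FiniteType k B := finiteType_chart k 𝒜 e₀ t ht
  -- (S1) the induced torus
  obtain ⟨R, _, _, 𝓡, _, e, he, _, hRsm, hunit, ⟨θ⟩⟩ :=
    hIT k m r B (chartPiece k 𝒜 e₀) hreg s (fun d hd => hsu d hd) hsfin
  haveI : Algebra.Smooth k R := hRsm
  -- the chart isomorphism `Γ(Y, U) ≃ R₀`, compatible with `k`
  let ε : Γ(Y, (U : Y.Opens)) ≃+* ↥(𝓡 0) :=
    e₀.trans ((zeroIdEquiv k 𝒜 e₀).trans θ.symm.toRingEquiv)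
  have hε : ∀ c : k, ε (algebraMap k _ c) = algebraMap k (↥(𝓡 0)) c := by
    intro c
    change θ.symm (zeroIdEquiv k 𝒜 e₀ (e₀ (algebraMap k _ c))) = _
    have h1 : zeroIdEquiv k 𝒜 e₀ (e₀ (algebraMap k _ c)) = algebraMap k _ c := by
      apply Subtype.ext
      change (e₀ (algebraMap k _ c) : B) = ((algebraMap k ↥(chartPiece k 𝒜 e₀ 0) c : _) : B)
      rw [SetLike.GradeZero.coe_algebraMap]
      rfl
    rw [h1]
    exact θ.symm.commutes c
  -- points: the prime `𝔭` of `y` in `Γ(Y, U)`, a maximal ideal `𝔪 ⊇ 𝔭`, their images `𝔮 ⊆ 𝔪'` in `R₀`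
  let 𝔭 : PrimeSpectrum Γ(Y, (U : Y.Opens)) := hU.primeIdealOf ⟨y, hyU⟩
  haveI : 𝔭.asIdeal.IsPrime := 𝔭.isPrime
  obtain ⟨𝔪, h𝔪, h𝔭𝔪⟩ := Ideal.exists_le_maximal 𝔭.asIdeal Ideal.IsPrime.ne_top'
  let 𝔮 : Ideal ↥(𝓡 0) := 𝔭.asIdeal.comap ε.symm.toRingHom
  let 𝔪' : Ideal ↥(𝓡 0) := 𝔪.comap ε.symm.toRingHom
  haveI h𝔮 : 𝔮.IsPrime := Ideal.IsPrime.comap _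
  haveI h𝔪' : 𝔪'.IsMaximal := Ideal.comap_isMaximal_of_surjective _ ε.symm.surjective
  have h𝔮𝔪' : 𝔮 ≤ 𝔪' := Ideal.comap_mono h𝔭𝔪
  -- a maximal ideal `P` of `R` over `𝔪'`
  obtain ⟨P, hP, hP𝔪'⟩ := exists_isMaximal_over 𝓡 𝔪'
  haveI := hP
  -- (S2) the slice at `P`
  obtain ⟨G, _, _, _, S, _, _, 𝒮, _, hSft, hSsm, _, _, hEt, tS, htS, htSP⟩ :=
    DatumToEmbedded.QuotientSingularities.exists_slice 𝓡 he hunit P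
  haveI := htS
  haveI := hEt
  haveI : tS.LiesOver 𝔪' := ⟨Ideal.ext fun r' => by
    rw [Ideal.under_def, Ideal.mem_comap]; exact (hP𝔪' r').symm.trans (htSP r').symm⟩
  -- (S3b) going down along the flat map `R₀ → S₀`
  obtain ⟨t', ht't, ht', ht'𝔮⟩ :=
    Ideal.exists_ideal_le_liesOver_of_le (p := 𝔮) (q := 𝔪') tS h𝔮𝔪'
  haveI := ht'
  -- the étale chart
  let ψ : Γ(Y, (U : Y.Opens)) →+* ↥(𝒮 0) := (algebraMap ↥(𝓡 0) ↥(𝒮 0)).comp ε.toRingHom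
  have hψ : ψ.Etale := RingHom.Etale.respectsIso.2 _ ε (RingHom.etale_algebraMap.2 hEt)
  haveI hSpecψ : Etale (Spec.map (CommRingCat.ofHom ψ)) :=
    (HasRingHomProperty.Spec_iff (P := @Etale)).2 hψ
  let φ : Spec (.of ↥(𝒮 0)) ⟶ Y := Spec.map (CommRingCat.ofHom ψ) ≫ hU.fromSpec
  refine ⟨G, ‹_›, ‹_›, ‹_›, S, ‹_›, ‹_›, 𝒮, ‹_›, hSft, hSsm, φ, inferInstance, ?_, ?_⟩
  · -- `y ∈ range φ`
    refine ⟨⟨t', ht'⟩, ?_⟩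
    change hU.fromSpec (Spec.map (CommRingCat.ofHom ψ) ⟨t', ht'⟩) = y
    have hpt : Spec.map (CommRingCat.ofHom ψ) ⟨t', ht'⟩ = 𝔭 := by
      rw [Spec.map_apply]
      apply PrimeSpectrum.ext
      rw [PrimeSpectrum.comap_asIdeal, CommRingCat.hom_ofHom,
        show ψ = (algebraMap ↥(𝓡 0) ↥(𝒮 0)).comp ε.toRingHom from rfl, ← Ideal.comap_comap,
        ← Ideal.under_def, ← ht'𝔮.over]
      change (𝔭.asIdeal.comap ε.symm.toRingHom).comap ε.toRingHom = 𝔭.asIdeal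
      rw [Ideal.comap_comap, RingEquiv.symm_toRingHom_comp_toRingHom, Ideal.comap_id]
    rw [hpt]
    exact hU.fromSpec_primeIdealOf ⟨y, hyU⟩
  · -- compatibility with the structure morphisms to `Spec k`
    change (Spec.map (CommRingCat.ofHom ψ) ≫ hU.fromSpec) ≫ g = _
    rw [Category.assoc, ← hφ₀, ← Spec.map_comp]
    congr 1
    apply CommRingCat.hom_ext
    refine RingHom.ext fun c => ?_
    simp only [CommRingCat.hom_comp, CommRingCat.hom_ofHom, RingHom.comp_apply]
    change algebraMap ↥(𝓡 0) ↥(𝒮 0) (ε (algebraMap k _ c)) = _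
    rw [hε, ← IsScalarTower.algebraMap_apply]

/-- **Line B after (S1)**: the skeleton's `stub_tameToBR` follows from the induced-torus statement alone
(composition with `stub_tameToBR_of`, p563790). [OURS · L1 W4.5c] -/
theorem stub_tameToBR_of_inducedTorus (hIT : InducedTorusStatement) :
    ∀ p : ℕ, p.Prime → GlobalKillTame p → GlobalKillBR p :=
  stub_tameToBR_of (tameBRExitCover_of_inducedTorus hIT)

end Main

end Summit.ResolutionOfSingularities.ResolutionOfSingularities.Theorems.WildQuotientResolution.S1.TameToBR

end
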